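import Summits.NavierStokesRegularity.FluidComputer.PalasekTowerLiveClassAtHelicity
import Literature.Analysis.FluidPDE.BeltramiFlows
import Literature.Analysis.FluidPDE.VorticityCalculus
import Literature.Analysis.FluidPDE.VectorCalculusProofs
import Literature.Analysis.FluidPDE.SolenoidalCZeroTestFields
import Literature.Analysis.FluidPDE.NSLerayHopfSereginEnergyProofs

/-!
# LIVE CONFINED DATA ARE DENSE — stub S4 `LiveConfinedDataDense` of the line «robustmirror»
# (cstrat-19179 g2, `Cruxes/EpisodeBase(T)/Lines/robustmirror.lean`) BY ITS UNFOLDED TEXT, with no hypothesis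

Cell `ns-blowup`, seat `ns-blowup-refuter4` (g10, K218; ledger refuter of record for route `PalasekTowerBreakdown` rev 19).
Negative-lane SUPPORT for the items `HeredityAtOneT` / `HeredityFromTwoT` (stmt-NavierStokesRegularity-20304/20305): the
line «robustmirror» refutes the pair `LiveHeredityAtOneT ∧ LiveHeredityFromTwoT` (hence the pair of record) from four named
statements S1–S4 (`not_liveHeredityPairT_of`, sorry-free); this file PAYS S4, the elementary one, so that the conditional
refutation is modulo S1 (robust sterile 2-D certificate = tranche-0), S2 (GIP openness, in print) and S3 (backward
uniqueness, in print) only. No Theses import; theorems only.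

STATEMENT (verbatim body of `RobustMirror.LiveConfinedDataDense`): next to any smooth divergence-free datum `u₀` confined to
the ball `‖x‖ ≤ r` (`r > 0`) there is, for every `ε > 0`, a smooth divergence-free rapidly decaying datum `a` confined to the
same ball, `ε`-close to `u₀` in value, in gradient (sup norms) and in `L³`, which is NOT a dead slice (not axisymmetric
swirl-free in any rigid placement).

PROOF: `a = u₀ + δ·W` with `W = curl (χ · v_ABC)`, `χ` a smooth bump `≡ 1` on `B(0, r/4)`, supported in `B(0, r/2)`,
`v_ABC` the Arnold–Beltrami–Childress field (`curl v_ABC = v_ABC`, tree `ABC.curl_abc`): `W` is smooth, compactly supported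
in `B(0, r/2)`, divergence-free (`div curl = 0`), and equals `curl v_ABC = v_ABC` near `0`, so its helicity density at `0` is
`‖v_ABC(0)‖² = 3 ≠ 0`. The helicity density of `u₀ + δW` at `0` is a quadratic polynomial in `δ` with leading coefficient
`3`, hence non-zero for some `δ ∈ {δ₀, δ₀/2, δ₀/3}`, `δ₀ = ε/(M₀ + M₁ + s₃ + 1)` (`M₀, M₁` sup bounds of `W, DW`, `s₃ = ‖W‖₃`);
a non-zero helicity density excludes every dead placement (`not_deadSlice_of_inner_self_curl_ne_zero`, fc-prover-2).
[cite: Moffatt1969, §1] [cite: MajdaBertozziCUP2002, §2.3.2 Example 2.8 eq. (2.49)]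

WHAT THIS IS NOT: not NS — an elementary density statement about data; no run, design, certificate or heredity claim;
S1–S3 and the items 20303/20304/20305 stay OPEN.
-/

noncomputable section

namespace Summit.NavierStokesRegularity.HeredityAtOneTLiveConfinedDense

open Set MeasureTheory Filter Topology Function Metric Real
open scoped ENNReal ContDiff NNReal RealInnerProductSpace
open Literature.Analysis.FluidPDE
open Summit.NavierStokesRegularity.FluidComputer.PalasekTowerClayBridge

/-- Three distinct arguments cannot all be roots of a quadratic with non-zero leading coefficient: some
`δ ∈ {δ₀, δ₀/2, δ₀/3}` is not a root. [folklore] -/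
private theorem exists_nonroot {h₀ L Q δ₀ : ℝ} (hQ : Q ≠ 0) (hδ₀ : 0 < δ₀) :
    ∃ δ, 0 < δ ∧ δ ≤ δ₀ ∧ h₀ + δ * L + δ ^ 2 * Q ≠ 0 := by
  by_contra! hcon
  have h1 := hcon δ₀ hδ₀ le_rfl
  have h2 := hcon (δ₀ / 2) (by positivity) (by linarith)
  have h3 := hcon (δ₀ / 3) (by positivity) (by linarith)
  have e12 : Q * (δ₀ + δ₀ / 2) + L = 0 := by
    have : (δ₀ - δ₀ / 2) * (Q * (δ₀ + δ₀ / 2) + L) = 0 := by linear_combination h1 - h2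
    rcases mul_eq_zero.1 this with h | h
    · linarith
    · exact h
  have e13 : Q * (δ₀ + δ₀ / 3) + L = 0 := by
    have : (δ₀ - δ₀ / 3) * (Q * (δ₀ + δ₀ / 3) + L) = 0 := by linear_combination h1 - h3
    rcases mul_eq_zero.1 this with h | h
    · linarith
    · exact h
  have : Q * (δ₀ / 6) = 0 := by linear_combination e12 - e13
  rcases mul_eq_zero.1 this with h | h
  · exact hQ h
  · linarith

/-- Confinement to a ball plus smoothness give rapid decay. [folklore] -/
private theorem hasRapidSpatialDecay_of_confined {u₀ : EuclideanSpace ℝ (Fin 3) → EuclideanSpace ℝ (Fin 3)} {r : ℝ}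
    (hu₀ : ContDiff ℝ ∞ u₀) (hconf : ∀ x, r < ‖x‖ → u₀ x = 0) : HasRapidSpatialDecay u₀ := by
  have hsupp : HasCompactSupport u₀ := by
    refine HasCompactSupport.of_support_subset_isCompact (isCompact_closedBall (0 : EuclideanSpace ℝ (Fin 3)) r) ?_
    intro x hx
    rw [Metric.mem_closedBall, dist_zero_right]
    by_contra h
    exact hx (hconf x (lt_of_not_ge h))
  exact HasRapidSpatialDecay.of_hasCompactSupport hu₀ hsupp

/-- `curl` is linear at a point of differentiability: `curl (u + δ • W) x = curl u x + δ • curl W x`. [folklore] -/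
private theorem curl_add_const_smul {u W : EuclideanSpace ℝ (Fin 3) → EuclideanSpace ℝ (Fin 3)}
    {x : EuclideanSpace ℝ (Fin 3)} (hu : DifferentiableAt ℝ u x) (hW : DifferentiableAt ℝ W x) (δ : ℝ) :
    curl (u + δ • W) x = curl u x + δ • curl W x := by
  have h1 : fderiv ℝ (u + δ • W) x = fderiv ℝ u x + δ • fderiv ℝ W x := by
    rw [fderiv_add hu (hW.const_smul δ : DifferentiableAt ℝ (δ • W) x), fderiv_const_smul hW]
  rw [curl_eq_curlCLM, curl_eq_curlCLM, curl_eq_curlCLM, h1, map_add, map_smul]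

/-- The ABC field `v_{1,1,1}` does not vanish at the origin (its first component there is `sin 0 + cos 0 = 1`).
[cite: MajdaBertozziCUP2002, §2.3.2 Example 2.8 eq. (2.49)] -/
private theorem abc_zero_ne_zero : ABC.abc 1 1 1 (0 : EuclideanSpace ℝ (Fin 3)) ≠ 0 := by
  intro h
  have h0 := congrArg (fun v : EuclideanSpace ℝ (Fin 3) => v 0) h
  simp at h0

/-- **A COMPACTLY SUPPORTED LIVE BUMP**: for every `r > 0` a smooth divergence-free field `W` on `ℝ³`, compactly supported,
vanishing for `‖x‖ > r/2`, with NON-ZERO helicity density at the origin (`W = curl (χ · v_ABC)`).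
[cite: MajdaBertozziCUP2002, §2.3.2 Example 2.8 eq. (2.49)] [cite: Moffatt1969, §1] -/
theorem exists_live_bump {r : ℝ} (hr : 0 < r) :
    ∃ W : EuclideanSpace ℝ (Fin 3) → EuclideanSpace ℝ (Fin 3),
      ContDiff ℝ ∞ W ∧ VectorCalculus.IsDivFree W ∧ HasCompactSupport W ∧ (∀ x, r / 2 < ‖x‖ → W x = 0) ∧
      ⟪W 0, curl W 0⟫ ≠ 0 := by
  let χ : ContDiffBump (0 : EuclideanSpace ℝ (Fin 3)) := ⟨r / 4, r / 2, by positivity, by linarith⟩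
  set V : EuclideanSpace ℝ (Fin 3) → EuclideanSpace ℝ (Fin 3) := fun x => χ x • ABC.abc 1 1 1 x with hVdef
  have hV : ContDiff ℝ ∞ V := χ.contDiff.smul (ABC.contDiff_abc 1 1 1)
  have hV2 : ContDiff ℝ 2 V := χ.contDiff.smul (ABC.contDiff_abc 1 1 1)
  have hVc : HasCompactSupport V := by
    have : HasCompactSupport ((⇑χ) • ABC.abc 1 1 1) := χ.hasCompactSupport.smul_right
    exact this
  -- outside `B(0, r/2)` the field `V` vanishes identically near every point
  have hV0 : ∀ x : EuclideanSpace ℝ (Fin 3), r / 2 < ‖x‖ → V =ᶠ[𝓝 x] fun _ => 0 := by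
    intro x hx
    have hopen : IsOpen {y : EuclideanSpace ℝ (Fin 3) | r / 2 < ‖y‖} := isOpen_lt continuous_const continuous_norm
    filter_upwards [hopen.mem_nhds hx] with y hy
    have hχ : χ y = 0 := χ.zero_of_le_dist (by simpa [dist_zero_right] using (le_of_lt hy))
    simp [hVdef, hχ]
  -- inside `B(0, r/4)` the field `V` is the ABC field near every point
  have hV1 : ∀ y ∈ Metric.ball (0 : EuclideanSpace ℝ (Fin 3)) (r / 4), V =ᶠ[𝓝 y] ABC.abc 1 1 1 := by
    intro y hy
    filter_upwards [χ.eventuallyEq_one_of_mem_ball hy] with z hz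
    simp [hVdef, hz]
  refine ⟨curl V, contDiff_curl (n := ⊤) (hV.of_le (by exact_mod_cast le_top)),
    fun x => divergence_curl_eq_zero_holds V hV2 x,
    hasCompactSupport_curl hVc, fun x hx => ?_, ?_⟩
  · rw [curl_eq_curlCLM, (hV0 x hx).fderiv_eq]
    simp
  · -- near `0`: `curl V = curl v_ABC = v_ABC`, hence `curl (curl V) 0 = curl v_ABC 0 = v_ABC 0`
    have hW1 : curl V =ᶠ[𝓝 0] ABC.abc 1 1 1 := by
      filter_upwards [Metric.ball_mem_nhds (0 : EuclideanSpace ℝ (Fin 3)) (by positivity : (0 : ℝ) < r / 4)]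
        with y hy
      rw [curl_eq_curlCLM, (hV1 y hy).fderiv_eq, ← curl_eq_curlCLM, ABC.curl_abc]
    have h0 : curl V 0 = ABC.abc 1 1 1 0 := hW1.eq_of_nhds
    have h1 : curl (curl V) 0 = ABC.abc 1 1 1 0 := by
      rw [curl_eq_curlCLM, hW1.fderiv_eq, ← curl_eq_curlCLM, ABC.curl_abc]
    rw [h0, h1, real_inner_self_eq_norm_sq]
    exact pow_ne_zero 2 (norm_ne_zero_iff.2 abc_zero_ne_zero)

/-- **LIVE CONFINED DATA ARE DENSE** — the statement `LiveConfinedDataDense` (stub S4 of the line «robustmirror»,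
`Cruxes/EpisodeBase/Lines/robustmirror.lean` and its `EpisodeBaseT` twin) BY ITS UNFOLDED TEXT, hypothesis-free: next to any
smooth divergence-free datum confined to `‖x‖ ≤ r`, `r > 0`, and for every `ε > 0`, a smooth divergence-free rapidly decaying
datum confined to the same ball, `ε`-close in value, gradient and `L³`, which is NOT a dead slice.
[cite: Moffatt1969, §1] [cite: MajdaBertozziCUP2002, §2.3.2 Example 2.8 eq. (2.49)] -/
theorem liveConfinedDataDense :
    ∀ (u₀ : EuclideanSpace ℝ (Fin 3) → EuclideanSpace ℝ (Fin 3)) (r ε : ℝ), 0 < r → 0 < ε →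
      ContDiff ℝ ∞ u₀ → VectorCalculus.IsDivFree u₀ → (∀ x, r < ‖x‖ → u₀ x = 0) →
      ∃ a : EuclideanSpace ℝ (Fin 3) → EuclideanSpace ℝ (Fin 3),
        ContDiff ℝ ∞ a ∧ VectorCalculus.IsDivFree a ∧ HasRapidSpatialDecay a ∧
        (∀ x, r < ‖x‖ → a x = 0) ∧ (∀ x, ‖a x - u₀ x‖ ≤ ε) ∧
        (∀ x, ‖fderiv ℝ a x - fderiv ℝ u₀ x‖ ≤ ε) ∧
        eLpNorm (a - u₀) 3 volume < ENNReal.ofReal ε ∧ ¬ DeadSlice a := by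
  intro u₀ r ε hr hε hu₀ hdiv hconf
  obtain ⟨W, hW, hWdiv, hWc, hW0, hQ⟩ := exists_live_bump hr
  -- sup bounds for `W`, `DW`, and the `L³` size of `W`
  obtain ⟨M₀, hM₀⟩ := hW.continuous.bounded_above_of_compact_support hWc
  obtain ⟨M₁, hM₁⟩ := (hW.continuous_fderiv (by simp)).bounded_above_of_compact_support (hWc.fderiv (𝕜 := ℝ))
  have hW3 : MemLp W 3 volume := hW.continuous.memLp_of_hasCompactSupport hWc
  set s := (eLpNorm W 3 volume).toReal with hsdef
  have hs0 : 0 ≤ s := ENNReal.toReal_nonneg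
  have hM₀0 : 0 ≤ M₀ := (norm_nonneg _).trans (hM₀ 0)
  have hM₁0 : 0 ≤ M₁ := (norm_nonneg _).trans (hM₁ 0)
  set K := M₀ + M₁ + s + 1 with hKdef
  have hK : 0 < K := by positivity
  set δ₀ := ε / K with hδ₀def
  have hδ₀ : 0 < δ₀ := div_pos hε hK
  have hδ₀K : δ₀ * K = ε := div_mul_cancel₀ ε hK.ne'
  -- differentiability facts
  have hu₀d : Differentiable ℝ u₀ := hu₀.differentiable (by simp)
  have hWd : Differentiable ℝ W := hW.differentiable (by simp)
  -- the helicity density of `u₀ + δ W` at `0` is a quadratic polynomial in `δ` with leading coefficient `⟪W 0, curl W 0⟫ ≠ 0`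
  obtain ⟨δ, hδ, hδle, hne⟩ := exists_nonroot (h₀ := ⟪u₀ 0, curl u₀ 0⟫)
    (L := ⟪u₀ 0, curl W 0⟫ + ⟪W 0, curl u₀ 0⟫) hQ hδ₀
  have hδK : δ * K ≤ ε := by nlinarith
  refine ⟨u₀ + δ • W, hu₀.add (hW.const_smul δ), ?_, ?_, ?_, ?_, ?_, ?_, ?_⟩
  · -- divergence-free
    have hδW : ContDiff ℝ 1 (δ • W) := (hW.const_smul δ).of_le (by exact_mod_cast le_top)
    refine isDivFree_add_of_contDiff (hu₀.of_le (by exact_mod_cast le_top)) hδW hdiv fun x => ?_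
    have h := hWdiv x
    unfold VectorCalculus.divergence at h ⊢
    rw [fderiv_const_smul (hWd x), ContinuousLinearMap.toLinearMap_smul, map_smul, h, smul_zero]
  · -- rapid decay (confined and smooth)
    refine hasRapidSpatialDecay_of_confined (r := r) (hu₀.add (hW.const_smul δ)) fun x hx => ?_
    simp [hconf x hx, hW0 x (by linarith)]
  · intro x hx
    simp [hconf x hx, hW0 x (by linarith)]
  · intro x
    have h1 : (u₀ + δ • W) x - u₀ x = δ • W x := by simp
    rw [h1, norm_smul, Real.norm_of_nonneg hδ.le]
    calc δ * ‖W x‖ ≤ δ * M₀ := mul_le_mul_of_nonneg_left (hM₀ x) hδ.le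
      _ ≤ δ * K := by apply mul_le_mul_of_nonneg_left _ hδ.le; linarith
      _ ≤ ε := hδK
  · intro x
    have h1 : fderiv ℝ (u₀ + δ • W) x - fderiv ℝ u₀ x = δ • fderiv ℝ W x := by
      rw [fderiv_add (hu₀d x) ((hWd x).const_smul δ : DifferentiableAt ℝ (δ • W) x), fderiv_const_smul (hWd x)]
      simp
    rw [h1, norm_smul, Real.norm_of_nonneg hδ.le]
    calc δ * ‖fderiv ℝ W x‖ ≤ δ * M₁ := mul_le_mul_of_nonneg_left (hM₁ x) hδ.le
      _ ≤ δ * K := by apply mul_le_mul_of_nonneg_left _ hδ.le; linarith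
      _ ≤ ε := hδK
  · have h1 : u₀ + δ • W - u₀ = δ • W := by abel
    rw [h1]
    refine eLpNorm_const_smul_le.trans_lt ?_
    have hS : eLpNorm W 3 volume = ENNReal.ofReal s := by rw [hsdef, ENNReal.ofReal_toReal hW3.eLpNorm_ne_top]
    rw [hS, Real.enorm_eq_ofReal hδ.le, ← ENNReal.ofReal_mul hδ.le, ENNReal.ofReal_lt_ofReal_iff hε]
    have hsK : s < K := by linarith
    calc δ * s ≤ δ₀ * s := mul_le_mul_of_nonneg_right hδle hs0
      _ < δ₀ * K := by
          rcases hs0.eq_or_lt with h | h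
          · rw [← h, mul_zero]; exact mul_pos hδ₀ hK
          · exact mul_lt_mul_of_pos_left hsK hδ₀
      _ = ε := hδ₀K
  · -- not a dead slice: helicity density at `0` is non-zero
    refine not_deadSlice_of_inner_self_curl_ne_zero ((hu₀.add (hW.const_smul δ)).of_le (by exact_mod_cast le_top))
      (x := 0) ?_
    rw [curl_add_const_smul (hu₀d 0) (hWd 0) δ]
    have h2 : (u₀ + δ • W) 0 = u₀ 0 + δ • W 0 := rfl
    rw [h2, inner_add_left, inner_add_right, inner_add_right, real_inner_smul_left, real_inner_smul_right,
      real_inner_smul_left, real_inner_smul_right]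
    have h3 : ⟪u₀ 0, curl u₀ 0⟫ + δ * ⟪u₀ 0, curl W 0⟫ + (δ * ⟪W 0, curl u₀ 0⟫ + δ * (δ * ⟪W 0, curl W 0⟫)) =
        ⟪u₀ 0, curl u₀ 0⟫ + δ * (⟪u₀ 0, curl W 0⟫ + ⟪W 0, curl u₀ 0⟫) + δ ^ 2 * ⟪W 0, curl W 0⟫ := by ring
    rw [h3]
    exact hne

end Summit.NavierStokesRegularity.HeredityAtOneTLiveConfinedDense

end
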